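import Literature.MathematicalPhysics.QuantumFieldTheory.BalabanImbrieJaffe1984to88.BIJ88Sect2Statements

/-!
# `BalabanImbrieJaffe1984to88.BIJ88SmallCoupling23` — T. Bałaban, J. Imbrie, A. Jaffe, *Effective action and cluster
properties of the abelian Higgs model*, Commun. Math. Phys. **114** (1988) 257–315 [BalabanImbrieJaffe1988]:
the SMALL-COUPLING REGIME behind the two printed scales **(2.3)** p. 260 *"r(e_k) = |log e_k⁻¹|^r, r > 1"* and **(2.33)**
p. 263 *"p(e_k) = |log e_k⁻¹|^p, p = O(1) is our logarithmic scale for small fields"* — PROVED: as `e_k → 0⁺`, every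
power of the logarithmic scale is eventually dominated by every exponential of the localization length,
`C·p(e_k) ≤ exp(c·r(e_k))` for all `C`, all `c > 0`, all exponents `p` and all `r > 0` (`eventually_pLog_le_exp_rLen`).
This discharges, for `e_k` small, the explicit *"r(e_k) large"* hypotheses under which the Sect. 5 model instances were
proved (`BIJ88Ineq576Proof.ineq576_Zd`: `a·N(1 + 4d/c₃)^d ≤ e^{c₁r(e_k)/4}` with `a = c·p(e_k)`;
`BIJ88Ineq555Proof.ineq555_matrix`: `C_σK_dS + C_HK_qK_η ≤ e^{c₁r(e_k)/2}`), in the form the paper uses them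
(p. 290 *"|A′(b_l)| ≤ cp(e_k), |w₅(b,b_l)| ≤ e^{−cr(e_k)}e^{−c dist(b,b_l)} and so …"*: powers of `p(e_k)` are absorbed by
`e^{−cr(e_k)}`).

statement-level skeleton of published theorems with citation tags; proofs where landed; nothing here is a claim about the Yang–Mills mass gap

PDF held: `paper:balaban1988-cmp114-bij-abelian-higgs-effective-action` (journal page = PDF page + 256); (2.3) p. 260 [PDF 4],
(2.33) p. 263 [PDF 7] as typed by r18 in `BIJ88Sect2Statements.rLen` / `pLog` (p239939).

CITATION HEADER (lean-in-tree rule).  Part of the lit-balaban TYPED SKELETON (HOME `run/shared/lean/pub/lit-balaban/`), Phase 2,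
seat p36 (gen 3, unit `lit-balaban-p36`); SUPPORT LEMMA for the rows C2.Eq5.7.5-5.7.6 / C2.Eq5.5.5 / C2.Eq5.4.7 of
`HOME/lit-balaban-r16/ROWS-C2-part2.md` (their «r(e_k) large» hypotheses), over r18's (2.3)/(2.33) definitions.  HOW:
`|log e_k⁻¹| → +∞` as `e_k → 0⁺` (`tendsto_abs_log_inv`); on `u → +∞`, `C·u^p·e^{−cu^r} = C·(u^r)^{p/r}e^{−c·u^r} → 0`
(Mathlib `tendsto_rpow_mul_exp_neg_mul_atTop_nhds_zero` composed with `u ↦ u^r → +∞`), hence eventually `< 1`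
(`eventually_mul_rpow_le_exp`).  Theorem-only; no new `Prop` facts; axioms standard.
-/

open Filter
open scoped Topology

namespace Literature.MathematicalPhysics.QuantumFieldTheory.BalabanImbrieJaffe1984to88.BIJ88SmallCoupling23

open BIJ88Sect2Statements (rLen pLog)

/-- `|log e_k⁻¹| → +∞` as `e_k → 0⁺` — the common base of the scales (2.3) `r(e_k)` and (2.33) `p(e_k)`.
[cite: BalabanImbrieJaffe1988, (2.3) p.260] -/
theorem tendsto_abs_log_inv : Tendsto (fun ek : ℝ => |Real.log ek⁻¹|) (𝓝[>] 0) atTop := by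
  have h2 : Tendsto (fun ek : ℝ => -Real.log ek) (𝓝[>] 0) atTop :=
    tendsto_neg_atBot_atTop.comp Real.tendsto_log_nhdsGT_zero
  have h3 : Tendsto (fun ek : ℝ => |-Real.log ek|) (𝓝[>] 0) atTop := tendsto_abs_atTop_atTop.comp h2
  refine h3.congr' (Eventually.of_forall fun ek => ?_)
  simp only [Real.log_inv]

/-- on `u → +∞`: `C·u^p ≤ exp(c·u^r)` eventually, for every `C`, `p` and every `c > 0`, `r > 0`.
[cite: BalabanImbrieJaffe1988, (2.3) p.260] -/
theorem eventually_mul_rpow_le_exp (C c p r : ℝ) (hc : 0 < c) (hr : 0 < r) :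
    ∀ᶠ u : ℝ in atTop, C * u ^ p ≤ Real.exp (c * u ^ r) := by
  have hg : Tendsto (fun x : ℝ => C * (x ^ (p / r) * Real.exp (-c * x))) atTop (𝓝 0) := by
    simpa using (tendsto_rpow_mul_exp_neg_mul_atTop_nhds_zero (p / r) c hc).const_mul C
  have hev : ∀ᶠ x : ℝ in atTop, C * (x ^ (p / r) * Real.exp (-c * x)) < 1 := hg.eventually (gt_mem_nhds one_pos)
  have hrp : r * (p / r) = p := by field_simp
  filter_upwards [(tendsto_rpow_atTop hr).eventually hev, eventually_ge_atTop 0] with u hu hu0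
  rw [← Real.rpow_mul hu0, hrp] at hu
  have hexp : 0 < Real.exp (c * u ^ r) := Real.exp_pos _
  have hsplit : C * u ^ p = C * (u ^ p * Real.exp (-c * u ^ r)) * Real.exp (c * u ^ r) := by
    rw [mul_assoc, mul_assoc, ← Real.exp_add, neg_mul, neg_add_cancel, Real.exp_zero, mul_one]
  rw [hsplit]
  calc C * (u ^ p * Real.exp (-c * u ^ r)) * Real.exp (c * u ^ r) ≤ 1 * Real.exp (c * u ^ r) :=
        mul_le_mul_of_nonneg_right hu.le hexp.le
    _ = Real.exp (c * u ^ r) := one_mul _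

/-- **THE SMALL-COUPLING REGIME of (2.3)/(2.33)**: for every constant `C`, every `c > 0`, every exponent `p` of the
logarithmic scale and every `r > 0` (the paper takes `r > 1`), `C·p(e_k) ≤ exp(c·r(e_k))` for all sufficiently small
`e_k > 0`. [cite: BalabanImbrieJaffe1988, (2.3) p.260] -/
theorem eventually_pLog_le_exp_rLen (C c p r : ℝ) (hc : 0 < c) (hr : 0 < r) :
    ∀ᶠ ek : ℝ in 𝓝[>] 0, C * pLog p ek ≤ Real.exp (c * rLen r ek) := by
  filter_upwards [tendsto_abs_log_inv.eventually (eventually_mul_rpow_le_exp C c p r hc hr)] with ek hek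
  simpa only [pLog, rLen] using hek

/-- powers of the logarithmic scale: `C·p(e_k)^N ≤ exp(c·r(e_k))` eventually (`p(e_k)^N = |log e_k⁻¹|^{pN}`).
[cite: BalabanImbrieJaffe1988, (2.33) p.263] -/
theorem eventually_pLog_pow_le_exp_rLen (C c p r : ℝ) (N : ℕ) (hc : 0 < c) (hr : 0 < r) :
    ∀ᶠ ek : ℝ in 𝓝[>] 0, C * pLog p ek ^ N ≤ Real.exp (c * rLen r ek) := by
  filter_upwards [eventually_pLog_le_exp_rLen C c (p * N) r hc hr] with ek hek
  have h : pLog p ek ^ N = pLog (p * N) ek := by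
    unfold pLog
    rw [← Real.rpow_natCast, ← Real.rpow_mul (abs_nonneg _)]
  rwa [h]

/-- constants alone: `K ≤ exp(c·r(e_k))` eventually — the shape of the hypothesis `hlarge` of
`BIJ88Ineq555Proof.ineq555_matrix` (`C_σK_dS + C_HK_qK_η ≤ e^{c₁r(e_k)/2}`, i.e. `c = c₁/2`). [cite: BalabanImbrieJaffe1988, (2.3) p.260] -/
theorem eventually_const_le_exp_rLen (K c r : ℝ) (hc : 0 < c) (hr : 0 < r) :
    ∀ᶠ ek : ℝ in 𝓝[>] 0, K ≤ Real.exp (c * rLen r ek) := by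
  filter_upwards [eventually_pLog_le_exp_rLen K c 0 r hc hr] with ek hek
  simpa [pLog] using hek

/-- the shape of the hypothesis `hlarge` of `BIJ88Ineq576Proof.ineq576_Zd` with `a = c_A·p(e_k)` (p. 290, *"|A′(b_l)| ≤ cp(e_k)"*)
and `ℓ = r(e_k)`: `c_A·p(e_k)·M ≤ exp(c₁·r(e_k)/4)` eventually, for any `M` (there `M = N(1 + 4d/c₃)^d`) and `c₁ > 0`.
[cite: BalabanImbrieJaffe1988, (5.7.6) p.290] -/
theorem eventually_hlarge576 (cA M c₁ p r : ℝ) (hc₁ : 0 < c₁) (hr : 0 < r) :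
    ∀ᶠ ek : ℝ in 𝓝[>] 0, cA * pLog p ek * M ≤ Real.exp (c₁ * rLen r ek / 4) := by
  filter_upwards [eventually_pLog_le_exp_rLen (cA * M) (c₁ / 4) p r (by positivity) hr] with ek hek
  calc cA * pLog p ek * M = cA * M * pLog p ek := by ring
    _ ≤ Real.exp (c₁ / 4 * rLen r ek) := hek
    _ = Real.exp (c₁ * rLen r ek / 4) := by ring_nf

end Literature.MathematicalPhysics.QuantumFieldTheory.BalabanImbrieJaffe1984to88.BIJ88SmallCoupling23
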